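import Literature.NumberTheory.Transcendental.ManyCurveSemistable
import Literature.NumberTheory.Transcendental.AnalyticSubgroupHyperplane
import Literature.NumberTheory.Transcendental.SemistabilityStdOfPhilippon
import HarnessLib

/-!
# Crux `RealOnePeriodRelations` (stmt-KontsevichZagierPeriods-10042),
# line `nash-retraction-thin-strip`, stub `stub_famHyperplaneOneClass`:
# the one-class case of the family hyperplane theorem

The multi-curve open-path layer of the line is conditional on Baker–Wüstholz's hyperplane
theorem (Thm. 6.15 in hyperplane form) for the quotients of the family group
`G = 𝔾ₐ × 𝔾ₘ^ι × ∏_b E_{M_{cls b}}♮` at GENERAL algebraic points, i.e. on the tree's predicate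
`(GaGmEFam.pres M cls ι hM).HyperplaneTheorem` (`LiePresentation.HyperplaneTheorem`,
`Literature/NumberTheory/Transcendental/SemistableTorsion.lean`; one field `apply` mentioning only
`P.algLie`, `P.Alg`, `P.ker`).

This file certifies that for ONE class — `J = Unit`, one lattice `L₀` without complex
multiplication, every block `b : B` of class `()` — the predicate is a THEOREM of the tree:

* `P₁ = GaGmEFam.pres (fun _ => L₀) (fun _ : B => ()) ι _` (`ManyCurveSemistable.lean`) has
  literally the kernel `GaGmEFam.ker = GaGmE.ker L₀ ι B` and the algebraic points
  `GaGmEFam.Alg = GaGmE.Alg L₀ ι B` of the one-curve presentation `P₀ = GaGmE.pres L₀ ι B h₂ h₃`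
  (`AnalyticSubgroupSemistable.lean`) — definitionally, once `L (cls b)` is `L₀`;
* and the same algebraic Lie subalgebras: with one class every `ℚ`-subspace `C ≤ ℚ^B` is
  block-diagonal (`GaGmEFam.restr (fun _ => ()) () c = c`), so the family data
  `GaGmEFam.SubgroupData ι B (fun _ => ())` and the one-curve data `GaGmE.SubgroupData ι B`
  correspond (`GaGmEFam.SubgroupData.toOne` and its inverse) with the same tangent spaces
  (`algLie_oneClass`);
* the hyperplane theorem for `P₀` at all algebraic points is
  `GaGmE.hyperplaneTheorem_pres_of_std_hyperplane` applied to the hyperplane form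
  `semistabilityTheorem_std_holds.hyperplane` of the discharged Semistability Theorem for the
  standard models `M_κ` (`SemistabilityStdOfPhilippon.lean`), and it transports field by field.

References: A. Baker, G. Wüstholz, *Logarithmic Forms and Diophantine Geometry*, New Math.
Monogr. 9, CUP 2007, Thm. 6.15, §6.7, §6.8. [BakerWustholz2007]
-/

noncomputable section

open Literature.NumberTheory.Transcendental

namespace Summit.KontsevichZagierPeriods.SymplecticScissors.RealOnePeriodRelations.MultiEllLayer

/-- With ONE class every `ℚ`-subspace of `ℚ^B` is block-diagonal: the restriction to the class
`()` is the identity. [folklore] -/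
theorem isBlockDiag_oneClass {B : Type} (C : Submodule ℚ (B → ℚ)) :
    GaGmEFam.IsBlockDiag (fun _ : B => ()) C := by
  intro c hc i
  have h : GaGmEFam.restr (fun _ : B => ()) i c = c := by
    funext b
    exact GaGmEFam.restr_apply_of_eq (fun _ : B => ()) (Subsingleton.elim _ _)
  rw [h]
  exact hc

/-- **One class: the algebraic Lie subalgebras of the family presentation are those of the
one-curve presentation.** [folklore] -/
theorem algLie_oneClass (ι B : Type) [Fintype ι] [Fintype B] :
    GaGmEFam.algLie (fun _ : B => ()) ι = GaGmE.algLie ι B := by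
  ext 𝔥
  constructor
  · rintro ⟨D, rfl⟩
    exact ⟨D.toOne, rfl⟩
  · rintro ⟨D, rfl⟩
    -- the one-curve datum `D` as family data for the constant class map (block-diagonality is
    -- automatic); its family tangent space is `D.toOne.tangent = D.tangent` definitionally
    exact ⟨⟨D.A, D.C, isBlockDiag_oneClass D.C, D.Ξ, D.compat⟩, rfl⟩

/-- One class: the kernel of the family presentation is the one-curve kernel. [folklore] -/
theorem ker_oneClass (L₀ : PeriodPair) (ι B : Type) [Fintype ι] [Fintype B] :
    GaGmEFam.ker (fun _ : Unit => L₀) (fun _ : B => ()) ι = GaGmE.ker L₀ ι B := rfl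

/-- One class: the algebraic points of the family presentation are the one-curve ones.
[folklore] -/
theorem alg_oneClass (L₀ : PeriodPair) (ι B : Type) [Fintype ι] [Fintype B] :
    GaGmEFam.Alg (fun _ : Unit => L₀) (fun _ : B => ()) ι = GaGmE.Alg L₀ ι B := rfl

/-- **The ONE-CLASS case of the family hyperplane theorem is a theorem of the tree**: for a
single lattice `L₀` without complex multiplication (all blocks in one class) the presentation
`GaGmEFam.pres (fun _ : Unit => L₀) (fun _ : B => ()) ι _` (the class family `J = Unit`; the
same term as the skeleton's spelling with the implicit `J` named) has the kernel, the algebraic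
points and the algebraic Lie subalgebras of the one-curve presentation `GaGmE.pres L₀ ι B h₂ h₃`
(`ker_oneClass`, `alg_oneClass`, `algLie_oneClass`), and the hyperplane theorem for the latter at
all algebraic points is `GaGmE.hyperplaneTheorem_pres_of_std_hyperplane` applied to
`semistabilityTheorem_std_holds.hyperplane`; the predicate `LiePresentation.HyperplaneTheorem`
transports field by field. [cite: BakerWustholz2007, Thm 6.15, §6.8] -/
theorem stub_famHyperplaneOneClass (L₀ : PeriodPair) (h₂ : IsAlgebraic ℚ L₀.g₂)
    (h₃ : IsAlgebraic ℚ L₀.g₃) (hCM : ¬ L₀.HasCM) (ι B : Type) [Fintype ι] [Fintype B] :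
    (GaGmEFam.pres (fun _ : Unit => L₀) (fun _ : B => ()) ι
      (fun _ => ⟨h₂, h₃⟩)).HyperplaneTheorem := by
  have hH : (GaGmE.pres L₀ ι B h₂ h₃).HyperplaneTheorem :=
    GaGmE.hyperplaneTheorem_pres_of_std_hyperplane semistabilityTheorem_std_holds.hyperplane
      L₀ h₂ h₃ hCM ι B
  have hLie : (GaGmEFam.pres (fun _ : Unit => L₀) (fun _ : B => ()) ι
      (fun _ => ⟨h₂, h₃⟩)).algLie = (GaGmE.pres L₀ ι B h₂ h₃).algLie :=
    algLie_oneClass ι B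
  refine ⟨fun 𝔥 h𝔥 W hWrat h𝔥W hWdim hmax w hwW hwAlg => ?_⟩
  rw [hLie] at h𝔥
  have hmax' : ∀ 𝔨 ∈ (GaGmE.pres L₀ ι B h₂ h₃).algLie, 𝔥 ≤ 𝔨 → 𝔨 ≤ W → 𝔨 = 𝔥 :=
    fun 𝔨 h𝔨 => hmax 𝔨 (hLie ▸ h𝔨)
  exact hH.apply 𝔥 h𝔥 W hWrat h𝔥W hWdim hmax' w hwW hwAlg

end Summit.KontsevichZagierPeriods.SymplecticScissors.RealOnePeriodRelations.MultiEllLayer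

end
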